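import Mathlib
import HarnessLib
import HarnessLib.Audit
import Summits.AtomisticToContinuum.Statement
import Literature.MathematicalPhysics.QuantumManyBody.PeriodicBoseGas

/-!
Route: BECParticleInduction

CLOSED (retired) 2026-08-15T13:39:18Z by operator:999:1257524 — reason: not-a-thesis: assembly does not conclude the sub-problem Statement — note: D-0027 §2.1 audit (human 2026-08-15: routes that do not decide the summit are removed): the assembly concludes `Literature.MathematicalPhysics.QuantumManyBody.BoseGas.BoseEinsteinCondensation`, not the sub-problem statement; a NEW conforming route may be opened from the same idea (generated `closes . The file is kept as the record of this route; refuted decls are indexed as negative knowledge (`ledger negatives`).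

# Route BECParticleInduction — One particle at a time — thermodynamic-limit BEC as a per-particle
increment of λ_max in the fixed Dirichlet box, each rung an equal-mass impurity problem

It suffices to show the ONE-PARTICLE INCREMENT BOUND at fixed box (card
AtomisticToContinuum/BoseEinsteinCondensation/one-particle-at-a-time, its STEP in the weakest
sufficient, mode-free form): for every repulsive finite-range radial v there are ρ₁ > 0 and L₀ such
that in every Dirichlet box Λ_L with L ≥ L₀ and for every particle number M with (M+1)/L³ ≤ ρ₁, the
ground-state condensate number (`condensateNumber` = λ_max of the one-particle density matrix of the
ground state, through near-minimisers) grows by at least 1/2 when ONE particle is added: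
λ_max(γ_(M+1)) ≥ λ_max(γ_M) + 1/2 ("a particle added to a dilute gas puts at least half a particle
into the existing condensate"; the expected truth is the Bogoliubov rate 1 − C√(ρ_M a³), whose
increments integrate exactly to the Lee–Huang–Yang depletion). Telescoping from M = 0
(condensateNumber = 0) INSIDE THE FINAL BOX L = (N/ρ)^(1/3) gives λ_max(γ_N) ≥ N/2 for all ρ < ρ₁
and all large N, i.e. HasGroundStateBEC v ρ with c = 1/2, ρ₀ = ρ₁: no boundary-condition transfer,
no induction on length scales, no spectral gap of the big box. X is decomposed at open into
StaticResponseBound (rank 3: the static density response m₋₁(k) of the TRUE M-particle ground state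
is ≤ C·M/(k² + ρ_M a) for all M in range — the Landau-free sum-rule input, typed as a second
difference of cosine-sourced ground-state energies) and BootstrapStep (rank 2: given the induction
hypothesis λ_max(γ_M') ≥ M'/2 for M' ≤ M and the response bound up to M+1, particle M+1 — a
distinguishable impurity of equal mass and equal coupling whose reduced density matrix is exactly
γ_(M+1)/(M+1) — deposits ≥ 1/2 into the condensate), plus the first rung GPWindowIncrement (rank 4:
the increment for M ≤ g₀L/a, Gross–Pitaevskii window). The glue StaticResponseBound → BootstrapStep
→ X (strong induction on M) and X → conjunct (telescoping, sideLength arithmetic) are PROVED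
sorry-free in the planner's Sketch.lean (theorems `glue`, `telescoping`, `assembly_of_cruxes :
Assembly`).
Lean: `∀ v : ℝ → ENNReal,
Literature.MathematicalPhysics.QuantumManyBody.BoseGas.IsRepulsiveFiniteRange v → ∃ ρ₁ L₀ : ℝ, 0 <
ρ₁ ∧ ∀ L : ℝ, L₀ ≤ L → ∀ M : ℕ, (M : ℝ) + 1 ≤ ρ₁ * L ^ 3 →
Literature.MathematicalPhysics.QuantumManyBody.BoseGas.condensateNumber v M L + 2⁻¹ ≤
Literature.MathematicalPhysics.QuantumManyBody.BoseGas.condensateNumber v (M + 1) L`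

## Assembly
StaticResponseBound → BootstrapStep → conjunct, by pure logic + ENNReal arithmetic: from
StaticResponseBound take (C, ρ₁ˢ, L₀ˢ), feed C to BootstrapStep to get (ρ₁ᵇ, L₀ᵇ), set ρ₁ := min, L₀
:= max; strong induction on n ≤ M+1 inside the box proves simultaneously ofReal(n/2) ≤
condensateNumber v n L and the increment (the response hypothesis at M' ≤ M+1 ≤ ρ₁L³ is
StaticResponseBound's conclusion verbatim) — this is IncrementBound (theorem `glue` in Sketch.lean,
sorry-free); then Telescoping (theorem `telescoping`). `theorem assembly_of_cruxes : Assembly := fun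
hS hB => telescoping (glue hS hB)` elaborates with rc 0, no sorry, in Sketch.lean: the Assembly item
is provable now by transcription (~110 lines).

Rationale: WHY THIS LINE. Every thermodynamic-limit attempt in print fights the vanishing spectral gap of the
big box: depletion ≤ L² × (excess energy) stops at GP-type scales (LSSY2005 Thm 5.1, Fournais2020
Thm 1.2, Junge2026 Cor. 6, ChongLiangNam2026; barrier KineticGapLengthScales, whose 2026-08-15 audit
shows the limitation is a theorem for ENERGY-WINDOW arguments and explicitly exempts λ_max-targets
and arguments using the true ground state's minimality/sum rules). This line never compares a state
with the box gap: it climbs in PARTICLE NUMBER at fixed box, M = 0 → N = ρL³, and each rung is a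
one-body problem — particle M+1 as an equal-mass, equal-coupling impurity in the bath Ψ_M (exact
identity: γ_(M+1)/(M+1) is the impurity's reduced density matrix; the symmetric ground state is the
ground state of the tagged sector by positivity), whose infrared dressing weight Σ_k |w_k|²
∫S_M(k,ω)dω/(ω+k²)² is finite in d = 3 as soon as the bath's STATIC response is bounded, by the
recoil inequality (ω+k²)² ≥ 4ωk² ⇒ ∫S/(ω+k²)² ≤ m₋₁(k)/(4k²) (shared with card
kv-insertion-corrector; ∫d³k m₋₁/k² converges in 3D, diverges in 1D as it must) — hence
StaticResponseBound is carried as its own crux and no Landau / phonon-linearity hypothesis is made.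
Imported areas: rigorous Bose-polaron / Fröhlich technology for the dressing of one particle by a
condensate (MysliwySeiringer2020, LampartTriay2025, arXiv:2311.05361, arXiv:2604.11976) — there in
mean-field scalings with BEC of the bath ASSUMED, here the bath is certified by the induction
hypothesis (opposite logical order); sum rules (Stringari1995 §2, PitaevskiiStringari1991: f-sum,
compressibility, S ≤ √(m₁m₋₁)) as the only bath input; Gross–Pitaevskii-regime condensation with
optimal rate and Bogoliubov theory in traps (BoccatoEtAl2019, arXiv:1801.01389, NamEtAl2022,
BrenneckeSchleinSchraven2022) for the first rung. What it does that the four open routes do not: it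
works in the audited DIRICHLET box directly (no BoundaryTransfer crux as in BECPeriodicReduction /
BECInfraredBound, for which nothing is in print), it targets λ_max mode-free (outside the
Galilei-boost obstruction of KineticGapLengthScalesNarrow), and it replaces "depletion ≤ L² × excess
energy" by "depletion is ½-Lipschitz in N" — a regularity-in-N statement no route or negative has
touched (negatives index empty 2026-08-15).

RANKED CRUXES. #0 IncrementBound (target) — X — per-particle increment of the ground-state
condensate number in a fixed Dirichlet box in the dilute range: ∀ repulsive finite-range v ∃ ρ₁>0,
L₀ ∀ L ≥ L₀ ∀ M with (M+1) ≤ ρ₁L³: condensateNumber v M L + 1/2 ≤ condensateNumber v (M+1) L.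
Sanity: v ≡ 0 gives increments exactly 1 at every density (product ground state); M = 0 → 1 is 0 →
1; M = 1 → 2 has deficit O(a²/L²) (unscreened pair correlation ∫(a/r)² over the box). Bogoliubov:
dN₀/dN = 1 − (4/√π)√(ρa³) ≥ 1/2 iff ρa³ ≤ π/64. [difficulty: open-problem] (why it might fail:
Differential (½-Lipschitz-in-N) form of TL-BEC at EVERY intermediate M ≤ ρ₁L³: strictly stronger
than the conjunct (audit point (b)); one depletion jump > 1/2 at a single M — a level crossing in
the dilute window for an exotic admissible v (hard shells) — refutes it while BEC survives.)
[LSSY2005 §1.2 (1.17)–(1.19) and Ch. 5 (5.1)–(5.2), BoccatoEtAl2019 (arXiv:1812.03086) Thm 1.1 —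
GP-regime depletion bounded uniformly (consistent with unit increments up to O(1)), Stringari1995
§2.2 (9)–(11), card AtomisticToContinuum/BoseEinsteinCondensation/one-particle-at-a-time (STEP,
audits 2 and 14)]
#2 BootstrapStep (crux) — the induction step as a ONE-PARTICLE (impurity-dressing) problem with the
bath certified: ∀ v ∀ C ∃ ρ₁>0, L₀ ∀ L ≥ L₀ ∀ M with (M+1) ≤ ρ₁L³: IF λ_max(γ_M') ≥ M'/2 for all M'
≤ M (induction hypothesis: the bath is condensed) AND the static-response inequality of
StaticResponseBound with constant C holds at every particle number M' ≤ M+1 in this box (∀ k ≠ 0 ∃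
t₀ ∀ t ∈ (0,t₀]: 2E₀(M') + 2tM' ≤ E₀(M'; +t) + E₀(M'; −t) + C t² M'/(|k|² + ρ_M' a), E₀(M'; ±t) =
inf over Dirichlet trial states of energy + Σ_j t(1 ± cos k·x_j), a = scatteringLength), THEN
condensateNumber v M L + 1/2 ≤ condensateNumber v (M+1) L. Mechanism: write H_(M+1) = H_M − Δ_y +
Σ_j v(y − x_j); γ_(M+1)/(M+1) is the reduced density matrix of the tagged particle y; renormalise
the two-body coupling (scattering solution, BoccatoEtAl2019-style), bound the dressing cloud of y at
second order by Σ_k |ŵ(k)|² ρ m₋₁(k)/(4k²L³) = O(√(ρ_M a³)) via the recoil inequality and the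
response hypothesis, control the remainder (one impurity, coupling ~ √(ρa³), Fröhlich/Nelson-type
with recoil: MysliwySeiringer2020, LampartTriay2025), and identify the undressed part with the
bath's top mode using the induction hypothesis. [deps: StaticResponseBound] [difficulty:
open-problem] (why it might fail: Needs all-orders control of ONE particle's dressing by a gapless
bath knowing only m₋₁: beyond 2nd order (recoil bound) Gavoret–Nozières-type logs or 3-body
recombination may enter; the bare coupling is hard-core strong until 2-body renormalisation;
per-step (Lipschitz) form is stronger than BEC.) [MysliwySeiringer2020 (arXiv:2003.12371) Thm 1 —
Fröhlich Hamiltonian for the Bose polaron, mean-field bath, LampartTriay2025 (arXiv:2411.11655) —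
validity of the (Bogoliubov–)Fröhlich model for a mobile impurity in a BEC, arXiv:2311.05361
(Hinrichs–Lampart) — critical momentum of an impurity in a BEC, arXiv:2604.11976
(Lampart–Pickl–Spruck 2026) — Bose polaron in the large-volume mean-field limit,
doi:10.1103/physreva.103.013317 (Guenther et al 2021) — residue finite for interacting bath,
orthogonality catastrophe for the ideal one, GavoretNozieres1964 — infrared structure of the T=0
Bose liquid (logs beyond one loop), Stringari1995 §2.2 (8)–(11) — S(k) ≤ √(m₁m₋₁), f-sum and
compressibility sum rules, BoccatoEtAl2019 (arXiv:1812.03086) §3–§6 — two-body renormalisation by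
generalised Bogoliubov transforms,
Literature.Barriers.AtomisticToContinuum.BogoliubovPerturbationInfrared]
#3 StaticResponseBound (crux) — uniform static density-response (compressibility-type) bound for the
TRUE ground state of every particle number in the dilute fixed box, typed as a symmetric second
difference of cosine-sourced Dirichlet ground-state energies (concavity in t gives the other
inequality for free; t(1 ± cos) ≥ 0 keeps potentials in ℝ≥0∞): ∀ v ∃ C, ρ₁>0, L₀ ∀ L ≥ L₀ ∀ M ≤ ρ₁L³
∀ k ≠ 0 ∃ t₀>0 ∀ t ∈ (0,t₀]: 2E₀(M) + 2tM ≤ E₀(M;+t,k) + E₀(M;−t,k) + C t² M/(|k|² + (M/L³)a).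
Equivalent (fixed M, L: gap, unique ground state) to m₋₁(Σ_j cos k·x_j) ≤ (C/2) M/(k² + ρ_M a), i.e.
χ(k) ≲ min(1/(ρa), 1/k²) — Bogoliubov value (ħ=2m=1) m₋₁ = (M/2)/(k² + 16πρa), so C = 1 at one loop;
free gas (a = 0): m₋₁ ≤ M/(2k²)-type bound, true. This is card kv-insertion-corrector's K1 in
Dirichlet form (one shared crux if that card is routed). [difficulty: open-problem] (why it might
fail: It is the INFINITESIMAL (m₋₁) static response of the TRUE ground state, uniform in M ≤ ρ₁L³, L
and k ≠ 0: energy-localisation bounds carry t-independent errors and never reach t → 0; it amounts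
to a one-direction gap (H−E₀ ≳ S(k)(k²+ρa) on ρ_kΨ₀); a soft density mode at some M kills it.)
[Stringari1995 §2.1 (7) and §2.2 (10) — f-sum and compressibility sum rules, 2m₋₁ = χ(q) → 1/mc²,
PitaevskiiStringari1991 — T=0 uncertainty-principle bounds, FournaisSolovej2020 (arXiv:1904.06164) —
LHY energy: e″(ρ) = 8πa(1+O(√(ρa³))) is the LDA value of χ(0)⁻¹ρ, BrenneckeSchleinSchraven2022
(arXiv:2108.11129) — Bogoliubov theory with external potentials in the GP regime (large-k / GP-box
input), BrenneckeEtAl2024 (arXiv:2401.00784) Thm 1 — coercivity H_N ≥ 4π𝔞N^(1+κ) + c𝒩₊ beyond GP,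
LSSY2005 Thm 2.4 (2.35) and Ch. 5 (5.15) — energy localisation and its t-independent losses, card
AtomisticToContinuum/BoseEinsteinCondensation/kv-insertion-corrector (crux K1, same bound on the
torus)]
#4 GPWindowIncrement (crux) — the FIRST RUNG — the increment in the Gross–Pitaevskii window of the
fixed Dirichlet cube: ∀ v (scatteringLength v ≠ ⊤) ∀ g₀ ∃ L₀ ∀ L ≥ L₀ ∀ M with (M+1)·a ≤ g₀·L:
condensateNumber v M L + 1/2 ≤ condensateNumber v (M+1) L. A special case of the Target (for L ≥
L₀(g₀,ρ₁)); the only rung where complete BEC is a theorem today (LiebSeiringer2002 / LSSY2005 Thm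
5.1 and 7.1; optimal rate: BoccatoEtAl2019 on the torus, NamEtAl2022 and
BrenneckeSchleinSchraven2022 in traps), so that d_M := M − λ_max(γ_M) = d_Bog(g_M) + o(1) uniformly
in g_M = Ma/L ≤ g₀ would give d_(M+1) − d_M = O(a/L) + o(1) ≤ 1/2. Cheapest place to kill the
ladder. [difficulty: XL] (why it might fail: Per-step increments need depletion asymptotics with
o(1) errors UNIFORM in g = Ma/L ≤ g₀ in the DIRICHLET cube and their M-differences at precision 1/2;
print covers the torus / smooth traps (BoccatoEtAl2019, NamEtAl2022, BrenneckeSchleinSchraven2022);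
oscillation of the depletion in M not excluded.) [LiebSeiringer2002 — complete BEC in the GP limit
(trap), LSSY2005 Thm 5.1 (5.4) and Thm 7.1, BoccatoEtAl2019 (arXiv:1812.03086) Thm 1.1 (1.9)–(1.10)
— optimal rate on the unit torus, NamEtAl2022 (arXiv:2001.04364) Thm 1 — optimal rate for trapped
bosons, BrenneckeSchleinSchraven2022 (arXiv:2108.11129) — depletion and spectrum for trapped bosons
in the GP regime, arXiv:1801.01389 (Boccato–Brennecke–Cenatiempo–Schlein, Acta Math. 2019) —
Bogoliubov theory in the GP limit, Literature.Barriers.AtomisticToContinuum.KineticGapLengthScales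
(LSSY2005_thm51_periodic: the periodic GP fact vendored)]
#9 Telescoping (support) — the Target implies the conjunct: given ρ₁, L₀ take ρ₀ := ρ₁, c := 1/2;
for ρ < ρ₀ and N ≥ ⌈ρ·max(L₀,0)³⌉ one has L = (N/ρ)^(1/3) ≥ L₀ and L³ = N/ρ, so (M+1) ≤ N ≤ ρ₁L³ for
all M < N; induction on M gives ofReal(M/2) ≤ condensateNumber v M L (base: ofReal 0 = 0), hence
ofReal(N/2) ≤ condensateNumber v N (sideLength ρ N). PROVED sorry-free in the planner's Sketch.lean
(theorem `telescoping`, ~45 lines: Real.rpow_natCast/rpow_mul, Nat.le_ceil, ENNReal.ofReal_add,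
ENNReal.ofReal_inv_of_pos); provable now by transcription. [difficulty: provable-now] [LSSY2005 §1.2
(1.19), Literature.MathematicalPhysics.QuantumManyBody.BoseGas.div_sideLength_pow_three (same
arithmetic)]

TWO-LAYER PLAN. Foreseen glued splits (none filed now; k ≤ 3, depth 1): BootstrapStep ⇐
SecondOrderDressing → RemainderControl → BootstrapStep (SecondOrderDressing: the increment deficit
is ≤ the recoil-bounded one-loop cloud weight C'∫d³k |ŵ(k)|² ρ m₋₁(k)/k² + o(1) — closes with
StaticResponseBound alone; RemainderControl: higher orders for one renormalised impurity at coupling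
√(ρa³)); StaticResponseBound ⇐ LargeKResponse (|k| ≳ ξ⁻¹: Neumann localisation to GP boxes +
BrenneckeSchleinSchraven2022-type Bogoliubov with external potential) → SmallKResponse (|k| ≲ ξ⁻¹:
the hard half — true-ground-state variational characterisation m₋₁ = sup_φ[2⟨φ,C̃_kΨ₀⟩ −
⟨φ,(H−E₀)φ⟩] against an LDA comparison) → StaticResponseBound. GPWindowIncrement is attacked
directly (Dirichlet-cube version of BoccatoEtAl2019/NamEtAl2022 with g-uniformity), no split
foreseen.

KILL CRITERIA. (1) A refutation of IncrementBound closes the route (`close --reason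
refuted:IncrementBound`) UNLESS the witness is a non-generic level crossing at isolated M — then the
one repair is `--restate IncrementBound` to the Cesàro form (Σ_(M<N) increments ≥ N/2, which is all
Telescoping uses) with the same decomposition. (2) A refutation of GPWindowIncrement (first rung,
richest technology) kills the ladder: close. (3) A refutation of StaticResponseBound by a soft
long-wavelength density mode forces a pivot to an explicit CONDITIONAL BRIDGE on a Landau-type
hypothesis (ω_min(k) ≥ c|k|) or closes the route; a refutation only at |k| ≫ ξ⁻¹ is repaired by
restating with min(1/(ρa),1/k²)·(log) slack (the dressing integral tolerates two powers, cf. card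
infrared-slack-audit-sinc-bound). (4) Mooted/superseded if BECPinning's PinnedLowerBound or
BECPeriodicReduction's PeriodicBEC + BoundaryTransferWeak are proved (close --reason superseded).
(5) If a refuter shows BootstrapStep's hypotheses are USELESS (i.e. exhibits baths satisfying both
hypotheses' analogues with increment < 1/2 in a model where the conclusion is checkable), the
decomposition — not the Target — is wrong: resplit.

NOT DECOMPOSED YET. Deliberately not filed at open: (i) the two-body renormalisation of the impurity
coupling (scattering solution / generalised Bogoliubov transform) inside BootstrapStep; (ii) the
second-order-vs-remainder split of BootstrapStep and the large-k/small-k split of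
StaticResponseBound (Two-layer plan) — filed only after GPWindowIncrement or StaticResponseBound
moves; (iii) the fixed-(N,L) spectral package provers will want (compact resolvent, uniqueness of
the Dirichlet ground state for v finite a.e. / connected hard-core domain, convergence of
near-minimisers, a common near-top mode of γ along minimising sequences) — these are `--supports`
lemmas of BootstrapStep, never items; (iv) constants: 1/2 (any ε < 1 works for Telescoping with c =
1 − ε), the Bogoliubov-rate version of the increment (1 − C(√(ρ_M a³) + a/L)), and the periodic-box
twin of the whole ladder (constant mode; would need BECPeriodicReduction's BoundaryTransferWeak,
which this line avoids on purpose).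

CHEAPEST FALSIFIER. For the line: exact diagonalisation / DMC of M = 2…8 soft-sphere bosons in a
Dirichlet cube at Ma/L ≈ 0.3–3 — is λ_max(γ_(M+1)) − λ_max(γ_M) ≥ 0.9 monotonically in M? (not run
this session: kit job not submitted; a refuter with `kit compute` should run it first — a single
non-monotone step at small M refutes GPWindowIncrement's spirit and likely the Target). Done by
hand: v ≡ 0 ⇒ increments = 1 (product state); Bogoliubov closed forms dN₀/dN = 1 − (4/√π)√(ρa³) (≥
1/2 iff ρa³ ≤ π/64 ≈ 0.049, fixing the scale of ρ₁) and m₋₁(Σcos k·x) = (M/2)/(k² + 16πρa) ≤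
(M/2)/(k² + ρa) (C = 1 at one loop); 1D transplant: ∫dk m₋₁/k² diverges, so the dimension test
cannot kill it cheaply. For StaticResponseBound specifically: check against the exactly solvable
Lieb–Liniger χ(k) transplanted to d = 1 is NOT a test (the bound is dimension-blind and true there);
the real cheap test is the free Dirichlet box at k → π/L (boundary-layer response), estimated ≤
t²L²ξ/(16πa) ≪ bulk t²L³/(16πa): passes.

NUMBERS. Units ħ = 2m = 1. Bogoliubov: depletion 1 − N₀/N = (8/(3√π))√(ρa³) [LSSY2005 Ch. 5 /
Bogolubov1966]; dN₀/dN = 1 − (4/√π)√(ρa³); spectrum e(k) = √(k⁴ + 16πρa k²), S(k) = k²/e(k),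
m₋₁(ρ_k)/N = S/e = 1/(k² + 16πρa), healing length ξ = (8πρa)^(−1/2); LHY: e(ρ) = 4πρ²a(1 +
(128/(15√π))√(ρa³)) [FournaisSolovej2020, YauYin2009]. Crossover of the per-step deficit: unscreened
M a²/L² = g·(a/L) for g = Ma/L ≲ 1 versus √(ρ_M a³) for g ≳ 1 (equal at g = 1). GP window covers M ≤
g₀L/a = g₀ N^(1/3)/(ρ^(1/3)a) of the N rungs (audit point (a): decorative for the TL, kept only as
first rung). Printed condensation scales: L ≲ C(ρa³)^(−δ)(ρa)^(−1/2) [Fournais2020 Thm 1.2], R ~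
a(ρa³)^(−3/4−η) [Junge2026 Cor. 6].

DEFINITION REQUESTS. None filed. A named `sourcedGroundStateEnergy v U N L := ⨅ Ψ : TrialState N L,
energy v Ψ + ∫⁻ X, (Σ_j U (X j))·‖Ψ X‖²` (one-body potential U : Space → ℝ≥0∞) in
Literature/MathematicalPhysics/QuantumManyBody would shorten StaticResponseBound and BootstrapStep
(now inlined as `⨅ Ψ, (energy v Ψ + ∫⁻ …)`) and let a grounder dedup StaticResponseBound against
card kv-insertion-corrector's K1 if that card is routed; bib keys LampartTriay2025,
MysliwySeiringer2020, BrenneckeSchleinSchraven2022, NamEtAl2022 were added to references.bib this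
session (ledger bib add, commit 9f5d68ce200c).

Novelty: Searches (2026-08-15; local searchd tier down — connection reset —, OpenAlex/arXiv/S2 HTTP 429,
zbMATH + Crossref + galaxy-substring answered): lit search --source zbmath "Bose polaron Bogoliubov
Frohlich impurity" (3: arXiv:2311.05361, arXiv:2411.11655, arXiv:2604.11976), "Bogoliubov theory
trapped bosons Gross-Pitaevskii Schraven" (arXiv:2108.11129, arXiv:2202.12294), "optimal rate
condensation … Napiorkowski Ricaud Triay" (arXiv:2001.04364), "Frohlich Hamiltonian Bose polaron
mean-field Mysliwy Seiringer" (arXiv:2003.12371); lit search --source crossref "mobile impurity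
Bose-Einstein condensate orthogonality catastrophe residue" (doi:10.1103/physreva.103.013317,
doi:10.1103/physrevlett.115.160401, doi:10.1103/physreva.63.013609), "condensate fraction chemical
potential derivative dilute Bose gas" (10 physics hits, none on λ_max(N+1) − λ_max(N)); lit search
--source zbmath "impurity Bose gas ground state overlap quasiparticle weight" (0), "linear response
dilute Bose gas rigorous local density approximation …" (0); lit galaxy search --star all
"quasiparticle residue impurity Bose condensate orthogonality" (0, panama saturated), --star pdf
"Bose polaron" (8 physics pdfs: arXiv:2105.10801 RG study of Bose polarons, arXiv:2112.06976, …);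
lit frontier AtomisticToContinuum --since 2020 (30: Junge2026 arXiv:2603.20776, ChongLiangNam2026
arXiv:2510.20493, arXiv:2602.16566 …); lit bridges --cross any (no polaron/induction bridge to the
Bose roots); plus the two refuter novelty audi  [refs: 10.1103/physreva.103.013317, 10.1103/physrevlett.115.160401, 10.1103/physreva.63.013609, 10.1016/0003-4916(87, 10.1002/cpa.21858, 2311.05361, 2411.11655, 2604.11976, 2108.11129, 2202.12294, 2001.04364, 2003.12371, 2105.10801, 2112.06976, 2603.20776, 2510.20493, 2602.16566, doi:10.1103/physreva.103.013317, doi:10.1103/physrevlett.115.160401, doi:10.1103/physreva.63.013609, doi:10.1016/0003-4916, do]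

Barriers (technique_class: induction-on-N; impurity-dressing; sum-rules; lambda-max): - technique_class: induction-on-N; impurity-dressing; sum-rules; lambda-max
- Literature.Barriers.AtomisticToContinuum.KineticGapLengthScales: evaded as a CLASS — no energy
window, no Poincaré/kinetic gap at any scale: the items are λ_max-targets on the true ground state
(condensateNumber, δ → 0) and the step uses its minimality through sum rules / second variation,
which KineticGapLengthScalesNarrow (2026-08-15 audit) lists as NOT bound; honest: BootstrapStep's
remainder may need (H_M − E_M)⁻¹ on the gapless range of the impurity coupling — the bet is that
only the small-k density sector matters and the recoil k² of the added particle is the infrared mass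
(first order certain, higher orders open).
- Literature.Barriers.AtomisticToContinuum.EnergyAsymptoticsWithoutCondensation: respected — no
inference from the VALUE of E₀ to two orders; energies enter only as a FAMILY of cosine-sourced
ground-state energies of the true state (StaticResponseBound), and the mechanism is d = 3-specific
(∫d³k m₋₁/k² < ∞; the Lieb–Liniger witness has a divergent dressing integral ∫dk/k… and Var ~ log
N), exactly the infrared fact the Narrow entry says an evading argument must use.
- Literature.Barriers.AtomisticToContinuum.BogoliubovPerturbationInfrared: APPLIES to BootstrapStep
beyond second order (T = 0, d = 3 expansion); evasion claimed only in part: one renormalised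
impurity with recoil and DENSITY (not phase/anomalous) couplings, first order finite with m₋₁ alone;
it does not evade the all-o

History (route lifecycle, newest last):
- 2026-08-15T13:39:18Z · CLOSED retired — not-a-thesis: assembly does not conclude the sub-problem Statement (operator:999:1257524)

sub-problem: BoseEinsteinCondensation · status: closed(retired) · opened planner-plancard-AtomisticToContinuum-BoseEin-5a9da1a9-0 2026-08-15T11:20:20Z · rev 0 · ledger route-AtomisticToContinuum-BECParticleInduction
GENERATED by the gate from the ledger (D-0016/17). Provers cite these decls: `theorem foo : Summit.AtomisticToContinuum.BoseEinsteinCondensation.Theses.BECParticleInduction.<Decl> := …` in Summits/AtomisticToContinuum/BoseEinsteinCondensation/Theorems/<Name>.lean.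
-/

namespace Summit.AtomisticToContinuum.BoseEinsteinCondensation.Theses.BECParticleInduction

open scoped BigOperators Topology Manifold Classical MeasureTheory ProbabilityTheory Matrix InnerProductSpace ComplexConjugate ContinuousMap
open Filter Set Function TopologicalSpace MeasureTheory

attribute [summit_statement] _root_.BoseEinsteinCondensation

/-- item stmt-AtomisticToContinuum-3588 · target · rank 0 · closed · moot by None · by planner
why it might fail: Differential (½-Lipschitz-in-N) form of TL-BEC at EVERY intermediate M ≤ ρ₁L³: strictly stronger than the conjunct (audit point (b)); one depletion jump > 1/2 at a single M — a level crossing in the dilute window for an exotic admissible v (hard shells) — refutes it while BEC survives.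
sources: LSSY2005 §1.2 (1.17)–(1.19) and Ch. 5 (5.1)–(5.2), BoccatoEtAl2019 (arXiv:1812.03086) Thm 1.1 — GP-regime depletion bounded uniformly (consistent with unit increments up to O(1)), Stringari1995 §2.2 (9)–(11), card AtomisticToContinuum/BoseEinsteinCondensation/one-particle-at-a-time (STEP, audits 2 and 14)
[target] X — per-particle increment of the ground-state condensate number in a fixed Dirichlet box
in the dilute range: ∀ repulsive finite-range v ∃ ρ₁>0, L₀ ∀ L ≥ L₀ ∀ M with (M+1) ≤ ρ₁L³:
condensateNumber v M L + 1/2 ≤ condensateNumber v (M+1) L. Sanity: v ≡ 0 gives increments exactly 1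
at every density (product ground state); M = 0 → 1 is 0 → 1; M = 1 → 2 has deficit O(a²/L²)
(unscreened pair correlation ∫(a/r)² over the box). Bogoliubov: dN₀/dN = 1 − (4/√π)√(ρa³) ≥ 1/2 iff
ρa³ ≤ π/64. [difficulty: open-problem] -/
@[route_item "route-AtomisticToContinuum-BECParticleInduction"]
def IncrementBound : Prop :=
  ∀ v : ℝ → ENNReal, Literature.MathematicalPhysics.QuantumManyBody.BoseGas.IsRepulsiveFiniteRange v → ∃ ρ₁ L₀ : ℝ, 0 < ρ₁ ∧ ∀ L : ℝ, L₀ ≤ L → ∀ M : ℕ, (M : ℝ) + 1 ≤ ρ₁ * L ^ 3 → Literature.MathematicalPhysics.QuantumManyBody.BoseGas.condensateNumber v M L + 2⁻¹ ≤ Literature.MathematicalPhysics.QuantumManyBody.BoseGas.condensateNumber v (M + 1) L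

/-- item stmt-AtomisticToContinuum-3589 · crux · rank 2 · closed · moot by None · by planner
why it might fail: Needs all-orders control of ONE particle's dressing by a gapless bath knowing only m₋₁: beyond 2nd order (recoil bound) Gavoret–Nozières-type logs or 3-body recombination may enter; the bare coupling is hard-core strong until 2-body renormalisation; per-step (Lipschitz) form is stronger than BEC.
sources: MysliwySeiringer2020 (arXiv:2003.12371) Thm 1 — Fröhlich Hamiltonian for the Bose polaron, mean-field bath, LampartTriay2025 (arXiv:2411.11655) — validity of the (Bogoliubov–)Fröhlich model for a mobile impurity in a BEC, arXiv:2311.05361 (Hinrichs–Lampart) — critical momentum of an impurity in a BEC, arXiv:2604.11976 (Lampart–Pickl–Spruck 2026) — Bose polaron in the large-volume mean-field limit, doi:10.1103/physreva.103.013317 (Guenther et al 2021) — residue finite for interacting bath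
[crux] the induction step as a ONE-PARTICLE (impurity-dressing) problem with the bath certified: ∀ v
∀ C ∃ ρ₁>0, L₀ ∀ L ≥ L₀ ∀ M with (M+1) ≤ ρ₁L³: IF λ_max(γ_M') ≥ M'/2 for all M' ≤ M (induction
hypothesis: the bath is condensed) AND the static-response inequality of StaticResponseBound with
constant C holds at every particle number M' ≤ M+1 in this box (∀ k ≠ 0 ∃ t₀ ∀ t ∈ (0,t₀]: 2E₀(M') +
2tM' ≤ E₀(M'; +t) + E₀(M'; −t) + C t² M'/(|k|² + ρ_M' a), E₀(M'; ±t) = inf over Dirichlet trial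
states of energy + Σ_j t(1 ± cos k·x_j), a = scatteringLength), THEN condensateNumber v M L + 1/2 ≤
condensateNumber v (M+1) L. Mechanism: write H_(M+1) = H_M − Δ_y + Σ_j v(y − x_j); γ_(M+1)/(M+1) is
the reduced density matrix of the tagged particle y; renormalise the two-body coupling (scattering
solution, BoccatoEtAl2019-style), bound the dressing cloud of y at second order by Σ_k |ŵ(k)|² ρ
m₋₁(k)/(4k²L³) = O(√(ρ_M a³)) via the recoil inequality and the response hypothesis, control the
remainder (one impurity, coupling ~ √(ρa³), Fröhlich/Nelson-type with recoil: MysliwySeiringer2020,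
LampartTriay2025), and identify the undressed part with the bath's top mode using the induction
hypothesis. [deps: S -/
@[route_item "route-AtomisticToContinuum-BECParticleInduction"]
def BootstrapStep : Prop :=
  ∀ v : ℝ → ENNReal, Literature.MathematicalPhysics.QuantumManyBody.BoseGas.IsRepulsiveFiniteRange v → ∀ C : ℝ, ∃ ρ₁ L₀ : ℝ, 0 < ρ₁ ∧ ∀ L : ℝ, L₀ ≤ L → ∀ M : ℕ, (M : ℝ) + 1 ≤ ρ₁ * L ^ 3 → (∀ M' : ℕ, M' ≤ M → ENNReal.ofReal ((M' : ℝ) / 2) ≤ Literature.MathematicalPhysics.QuantumManyBody.BoseGas.condensateNumber v M' L) → (∀ M' : ℕ, M' ≤ M + 1 → ∀ k : EuclideanSpace ℝ (Fin 3), k ≠ 0 → ∃ t₀ : ℝ, 0 < t₀ ∧ ∀ t : ℝ, 0 < t → t ≤ t₀ → 2 * Literature.MathematicalPhysics.QuantumManyBody.BoseGas.groundStateEnergy v M' L + ENNReal.ofReal (2 * t * (M' : ℝ)) ≤ (⨅ Ψ : Literature.MathematicalPhysics.QuantumManyBody.BoseGas.TrialState M' L, (Literature.MathematicalPhysics.QuantumManyBody.BoseGas.energy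 v Ψ + ∫⁻ X, (∑ j : Fin M', ENNReal.ofReal (t * (1 + Real.cos (∑ i : Fin 3, k i * X j i)))) * (‖Ψ.ψ X‖₊ : ENNReal) ^ 2)) + (⨅ Ψ : Literature.MathematicalPhysics.QuantumManyBody.BoseGas.TrialState M' L, (Literature.MathematicalPhysics.QuantumManyBody.BoseGas.energy v Ψ + ∫⁻ X, (∑ j : Fin M', ENNReal.ofReal (t * (1 - Real.cos (∑ i : Fin 3, k i * X j i)))) * (‖Ψ.ψ X‖₊ : ENNReal) ^ 2)) + ENNReal.ofReal (C * t ^ 2 * (M' : ℝ) / (‖k‖ ^ 2 + (M' : ℝ) / L ^ 3 * (Literature.MathematicalPhysics.QuantumManyBody.BoseGas.scatteringLength v).toReal))) → Literature.MathematicalPhysics.QuantumManyBody.BoseGas.condensateNumber v M L + 2⁻¹ ≤ Literature.MathematicalPhysics.QuantumManyBody.BoseGas.condensateNumber v (M + 1) L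

/-- item stmt-AtomisticToContinuum-3590 · crux · rank 3 · closed · moot by None · by planner
why it might fail: It is the INFINITESIMAL (m₋₁) static response of the TRUE ground state, uniform in M ≤ ρ₁L³, L and k ≠ 0: energy-localisation bounds carry t-independent errors and never reach t → 0; it amounts to a one-direction gap (H−E₀ ≳ S(k)(k²+ρa) on ρ_kΨ₀); a soft density mode at some M kills it.
sources: Stringari1995 §2.1 (7) and §2.2 (10) — f-sum and compressibility sum rules, 2m₋₁ = χ(q) → 1/mc², PitaevskiiStringari1991 — T=0 uncertainty-principle bounds, FournaisSolovej2020 (arXiv:1904.06164) — LHY energy: e″(ρ) = 8πa(1+O(√(ρa³))) is the LDA value of χ(0)⁻¹ρ, BrenneckeSchleinSchraven2022 (arXiv:2108.11129) — Bogoliubov theory with external potentials in the GP regime (large-k / GP-box input), BrenneckeEtAl2024 (arXiv:2401.00784) Thm 1 — coercivity H_N ≥ 4π𝔞N^(1+κ) + c𝒩₊ beyond GP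
[crux] uniform static density-response (compressibility-type) bound for the TRUE ground state of
every particle number in the dilute fixed box, typed as a symmetric second difference of
cosine-sourced Dirichlet ground-state energies (concavity in t gives the other inequality for free;
t(1 ± cos) ≥ 0 keeps potentials in ℝ≥0∞): ∀ v ∃ C, ρ₁>0, L₀ ∀ L ≥ L₀ ∀ M ≤ ρ₁L³ ∀ k ≠ 0 ∃ t₀>0 ∀ t ∈
(0,t₀]: 2E₀(M) + 2tM ≤ E₀(M;+t,k) + E₀(M;−t,k) + C t² M/(|k|² + (M/L³)a). Equivalent (fixed M, L:
gap, unique ground state) to m₋₁(Σ_j cos k·x_j) ≤ (C/2) M/(k² + ρ_M a), i.e. χ(k) ≲ min(1/(ρa),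
1/k²) — Bogoliubov value (ħ=2m=1) m₋₁ = (M/2)/(k² + 16πρa), so C = 1 at one loop; free gas (a = 0):
m₋₁ ≤ M/(2k²)-type bound, true. This is card kv-insertion-corrector's K1 in Dirichlet form (one
shared crux if that card is routed). [difficulty: open-problem] -/
@[route_item "route-AtomisticToContinuum-BECParticleInduction"]
def StaticResponseBound : Prop :=
  ∀ v : ℝ → ENNReal, Literature.MathematicalPhysics.QuantumManyBody.BoseGas.IsRepulsiveFiniteRange v → ∃ C ρ₁ L₀ : ℝ, 0 < ρ₁ ∧ ∀ L : ℝ, L₀ ≤ L → ∀ M : ℕ, (M : ℝ) ≤ ρ₁ * L ^ 3 → ∀ k : EuclideanSpace ℝ (Fin 3), k ≠ 0 → ∃ t₀ : ℝ, 0 < t₀ ∧ ∀ t : ℝ, 0 < t → t ≤ t₀ → 2 * Literature.MathematicalPhysics.QuantumManyBody.BoseGas.groundStateEnergy v M L + ENNReal.ofReal (2 * t * (M : ℝ)) ≤ (⨅ Ψ : Literature.MathematicalPhysics.QuantumManyBody.BoseGas.TrialState M L, (Literature.MathematicalPhysics.QuantumManyBody.BoseGas.energy v Ψ + ∫⁻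 X, (∑ j : Fin M, ENNReal.ofReal (t * (1 + Real.cos (∑ i : Fin 3, k i * X j i)))) * (‖Ψ.ψ X‖₊ : ENNReal) ^ 2)) + (⨅ Ψ : Literature.MathematicalPhysics.QuantumManyBody.BoseGas.TrialState M L, (Literature.MathematicalPhysics.QuantumManyBody.BoseGas.energy v Ψ + ∫⁻ X, (∑ j : Fin M, ENNReal.ofReal (t * (1 - Real.cos (∑ i : Fin 3, k i * X j i)))) * (‖Ψ.ψ X‖₊ : ENNReal) ^ 2)) + ENNReal.ofReal (C * t ^ 2 * (M : ℝ) / (‖k‖ ^ 2 + (M : ℝ) / L ^ 3 * (Literature.MathematicalPhysics.QuantumManyBody.BoseGas.scatteringLength v).toReal))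

/-- item stmt-AtomisticToContinuum-3591 · crux · rank 4 · closed · moot by None · by planner
why it might fail: Per-step increments need depletion asymptotics with o(1) errors UNIFORM in g = Ma/L ≤ g₀ in the DIRICHLET cube and their M-differences at precision 1/2; print covers the torus / smooth traps (BoccatoEtAl2019, NamEtAl2022, BrenneckeSchleinSchraven2022); oscillation of the depletion in M not excluded.
sources: LiebSeiringer2002 — complete BEC in the GP limit (trap), LSSY2005 Thm 5.1 (5.4) and Thm 7.1, BoccatoEtAl2019 (arXiv:1812.03086) Thm 1.1 (1.9)–(1.10) — optimal rate on the unit torus, NamEtAl2022 (arXiv:2001.04364) Thm 1 — optimal rate for trapped bosons, BrenneckeSchleinSchraven2022 (arXiv:2108.11129) — depletion and spectrum for trapped bosons in the GP regime, arXiv:1801.01389 (Boccato–Brennecke–Cenatiempo–Schlein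
[crux] the FIRST RUNG — the increment in the Gross–Pitaevskii window of the fixed Dirichlet cube: ∀
v (scatteringLength v ≠ ⊤) ∀ g₀ ∃ L₀ ∀ L ≥ L₀ ∀ M with (M+1)·a ≤ g₀·L: condensateNumber v M L + 1/2
≤ condensateNumber v (M+1) L. A special case of the Target (for L ≥ L₀(g₀,ρ₁)); the only rung where
complete BEC is a theorem today (LiebSeiringer2002 / LSSY2005 Thm 5.1 and 7.1; optimal rate:
BoccatoEtAl2019 on the torus, NamEtAl2022 and BrenneckeSchleinSchraven2022 in traps), so that d_M :=
M − λ_max(γ_M) = d_Bog(g_M) + o(1) uniformly in g_M = Ma/L ≤ g₀ would give d_(M+1) − d_M = O(a/L) +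
o(1) ≤ 1/2. Cheapest place to kill the ladder. [difficulty: XL] -/
@[route_item "route-AtomisticToContinuum-BECParticleInduction"]
def GPWindowIncrement : Prop :=
  ∀ v : ℝ → ENNReal, Literature.MathematicalPhysics.QuantumManyBody.BoseGas.IsRepulsiveFiniteRange v → Literature.MathematicalPhysics.QuantumManyBody.BoseGas.scatteringLength v ≠ ⊤ → ∀ g₀ : ℝ, ∃ L₀ : ℝ, ∀ L : ℝ, L₀ ≤ L → ∀ M : ℕ, ((M : ℝ) + 1) * (Literature.MathematicalPhysics.QuantumManyBody.BoseGas.scatteringLength v).toReal ≤ g₀ * L → Literature.MathematicalPhysics.QuantumManyBody.BoseGas.condensateNumber v M L + 2⁻¹ ≤ Literature.MathematicalPhysics.QuantumManyBody.BoseGas.condensateNumber v (M + 1) L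

/-- item stmt-AtomisticToContinuum-3592 · support · rank 9 · closed · moot by None · by planner
sources: LSSY2005 §1.2 (1.19), Literature.MathematicalPhysics.QuantumManyBody.BoseGas.div_sideLength_pow_three (same arithmetic)
[support] the Target implies the conjunct: given ρ₁, L₀ take ρ₀ := ρ₁, c := 1/2; for ρ < ρ₀ and N ≥
⌈ρ·max(L₀,0)³⌉ one has L = (N/ρ)^(1/3) ≥ L₀ and L³ = N/ρ, so (M+1) ≤ N ≤ ρ₁L³ for all M < N;
induction on M gives ofReal(M/2) ≤ condensateNumber v M L (base: ofReal 0 = 0), hence ofReal(N/2) ≤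
condensateNumber v N (sideLength ρ N). PROVED sorry-free in the planner's Sketch.lean (theorem
`telescoping`, ~45 lines: Real.rpow_natCast/rpow_mul, Nat.le_ceil, ENNReal.ofReal_add,
ENNReal.ofReal_inv_of_pos); provable now by transcription. [difficulty: provable-now] -/
@[route_item "route-AtomisticToContinuum-BECParticleInduction"]
def Telescoping : Prop :=
  (∀ v : ℝ → ENNReal, Literature.MathematicalPhysics.QuantumManyBody.BoseGas.IsRepulsiveFiniteRange v → ∃ ρ₁ L₀ : ℝ, 0 < ρ₁ ∧ ∀ L : ℝ, L₀ ≤ L → ∀ M : ℕ, (M : ℝ) + 1 ≤ ρ₁ * L ^ 3 → Literature.MathematicalPhysics.QuantumManyBody.BoseGas.condensateNumber v M L + 2⁻¹ ≤ Literature.MathematicalPhysics.QuantumManyBody.BoseGas.condensateNumber v (M + 1) L) → Literature.MathematicalPhysics.QuantumManyBody.BoseGas.BoseEinsteinCondensation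

/-- item stmt-AtomisticToContinuum-3593 · assembly · rank 1 · closed · moot by None · by planner
sources: LSSY2005 §1.2 (1.19), planner Sketch.lean theorems glue / telescoping / assembly_of_cruxes (sorry-free, lean check rc 0, 2026-08-15)
[assembly] StaticResponseBound → BootstrapStep → BoseEinsteinCondensation (the conjunct constant
Literature.MathematicalPhysics.QuantumManyBody.BoseGas.BoseEinsteinCondensation, definitionally the
audited `BoseEinsteinCondensation`). -/
@[route_item "route-AtomisticToContinuum-BECParticleInduction"]
def Assembly : Prop :=
  StaticResponseBound → BootstrapStep → Literature.MathematicalPhysics.QuantumManyBody.BoseGas.BoseEinsteinCondensation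

end Summit.AtomisticToContinuum.BoseEinsteinCondensation.Theses.BECParticleInduction
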